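import Summits.CriticalPhenomena.PercolationContinuityZ3.Theorems.SahiMasterFamilySharedCoordinatePoly

/-!
# The leading coefficient of `E_k` in a coordinate shared by all but one event, and the APEX criterion (all orders)

Support file of the master-family programme (crux `NoHeavyLowerTail`, stmt-CriticalPhenomena-4575; cell `prim-masterthm`, seat P4,
unit `prim-masterthm-p4-g7`).  Seat document HOME/prim-masterthm-p4/EQI3-RIGIDITY-PROOF.md §2 (the `(k−1)`-shared-coordinate detectors).

Writing the indicator of an increasing event as `1_U = 1_{U^{e←0}} + x_e·1_{Piv_e U}` (`Piv_e U = U^{e←1} ∖ U^{e←0}`, the configurations at which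
`e` is pivotal; `ind_eq_secAt_add_xInd_mul`) and expanding by multilinearity (`exists_poly_pfam`), with the polynomial bookkeeping of
`SahiMasterFamilySharedCoordinatePoly`:

* **`exists_poly_sahiE_update`** — for `n + 2` events `U_0, U_1, …, U_{n+1}` with `U_0` `e`-free and `U_1..U_{n+1}` increasing,
  `s ↦ E_{n+2}(μ_{p[e↦s]}; 1_U)` is a polynomial of degree `≤ n + 1` whose `s^{n+1}`-coefficient is
  `topCoeff = (−1)^n · [ Σ_i E(1_{Piv_e U_i} 1_{U_0}) ∏_{j≠i} E(1_{Piv_e U_j}) − E(1_{U_0}) ∏_j E(1_{Piv_e U_j}) ]`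
  (for `n + 2 = 3` this is the `t²`-coefficient `C_2` of EQI3-RIGIDITY-PROOF §2 whose vanishing locus is THEOREM R₃ there);
* **`exists_interior_sahiE_ne_zero_of_topCoeff_ne_zero`** — THE `(k−1)`-SHARED-COORDINATE DETECTOR (all orders): `topCoeff ≠ 0` at a parameter
  vector interior off `e` ⇒ `E_{n+2}(μ_q; 1_U) ≠ 0` for some interior `q` (a degree-`≤ n+1` polynomial vanishing at `n + 2` points is zero);
* **`exists_interior_sahiE_ne_zero_of_apex`** — THE APEX CRITERION (all orders): if `e` is pivotal for `U_1,…,U_{n+1}`, lies in EVERY configuration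
  of `U_1`, and `U_1^{e←1}` is strictly correlated with `U_0`, then `E_{n+2} ≢ 0` (the bracket is `≥ Cov(U_1^{e←1},U_0)·∏_{j≥2} μ(Piv_e U_j) > 0`
  by Harris).
HONEST FRAMING: criteria for NON-vanishing of `E_k` (the identically-zero programme (EQI-k)); nothing here bears on Sahi positivity `C_k`, Kahn's
Conj. 5 or the master theorem, which remain OPEN.  [this work]
-/

noncomputable section

open scoped Classical
open Polynomial

namespace Summit.CriticalPhenomena.PercolationContinuityZ3.Theorems

open Finset Function
open Literature.Combinatorics.Sahi2008
open Literature.Probability.Percolation.DecisionTree (ind ind_of_mem ind_of_not_mem ind_nonneg)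

namespace SharedCoordinate

variable {ι : Type*} [Fintype ι] (p : ι → unitInterval) (e : ι)

/-! ### Events: `1_U = 1_{U^{e←0}} + x_e · 1_{Piv_e U}` and the expansion by multilinearity -/

/-- The configurations at which `e` is PIVOTAL for `A`: `A^{e←1} ∖ A^{e←0}`. [this work] -/
def pivSet (e : ι) (A : Set (Set ι)) : Set (Set ι) := secAt e true A \ secAt e false A

omit [Fintype ι] in
/-- Indicators of sections are `e`-free. [this work] -/
theorem ignores_ind_secAt (e : ι) (b : Bool) (A : Set (Set ι)) : Ignores e (ind (secAt e b A)) :=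
  fun ω => ind_secAt_insert e b A ω

omit [Fintype ι] in
/-- The indicator of the pivotal set is `e`-free. [this work] -/
theorem ignores_ind_pivSet (e : ι) (A : Set (Set ι)) : Ignores e (ind (pivSet e A)) := fun ω => by
  have h : insert e ω ∈ pivSet e A ↔ ω ∈ pivSet e A := by
    rw [pivSet, Set.mem_sdiff, Set.mem_sdiff, insert_mem_secAt_iff, insert_mem_secAt_iff]
  by_cases hω : ω ∈ pivSet e A
  · rw [ind_of_mem hω, ind_of_mem (h.2 hω)]
  · rw [ind_of_not_mem hω, ind_of_not_mem fun h' => hω (h.1 h')]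

omit [Fintype ι] in
/-- An `e`-free EVENT (`insert e ω ∈ A ↔ ω ∈ A`) has an `e`-free indicator. [this work] -/
theorem ignores_ind_of_forall_iff {e : ι} {A : Set (Set ι)} (hA : ∀ ω, insert e ω ∈ A ↔ ω ∈ A) : Ignores e (ind A) := fun ω => by
  by_cases hω : ω ∈ A
  · rw [ind_of_mem hω, ind_of_mem ((hA ω).2 hω)]
  · rw [ind_of_not_mem hω, ind_of_not_mem fun h => hω ((hA ω).1 h)]

omit [Fintype ι] in
/-- **`1_A = 1_{A^{e←0}} + x_e · 1_{Piv_e A}`** for an increasing event `A`. [this work] -/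
theorem ind_eq_secAt_add_xInd_mul (e : ι) {A : Set (Set ι)} (hA : IsUpperSet A) :
    ind A = ind (secAt e false A) + xInd e * ind (pivSet e A) := by
  funext ω
  simp only [Pi.add_apply, Pi.mul_apply, xInd]
  have h0 : ω ∈ secAt e false A ↔ ω \ {e} ∈ A := mem_secAt
  have h1 : ω ∈ secAt e true A ↔ insert e ω ∈ A := mem_secAt
  by_cases he : e ∈ ω
  · rw [if_pos he, one_mul]
    have hins : insert e ω = ω := Set.insert_eq_of_mem he
    by_cases hd : ω \ {e} ∈ A
    · have hωA : ω ∈ A := hA Set.sdiff_subset hd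
      have hnp : ω ∉ pivSet e A := fun h => (Set.mem_sdiff _).1 h |>.2 (h0.2 hd)
      rw [ind_of_mem hωA, ind_of_mem (h0.2 hd), ind_of_not_mem hnp]; ring
    · by_cases hωA : ω ∈ A
      · have hp : ω ∈ pivSet e A := (Set.mem_sdiff _).2 ⟨h1.2 (hins.symm ▸ hωA), fun h => hd (h0.1 h)⟩
        rw [ind_of_mem hωA, ind_of_not_mem fun h => hd (h0.1 h), ind_of_mem hp]; ring
      · have hnp : ω ∉ pivSet e A := fun h => hωA (hins ▸ h1.1 ((Set.mem_sdiff _).1 h).1)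
        rw [ind_of_not_mem hωA, ind_of_not_mem fun h => hd (h0.1 h), ind_of_not_mem hnp]; ring
  · rw [if_neg he, zero_mul, add_zero]
    have hsd : ω \ {e} = ω := Set.sdiff_singleton_eq_self he
    by_cases hωA : ω ∈ A
    · rw [ind_of_mem hωA, ind_of_mem (h0.2 (hsd.symm ▸ hωA))]
    · rw [ind_of_not_mem hωA, ind_of_not_mem fun h => hωA (hsd ▸ h0.1 h)]

section Events

variable {n : ℕ} (U : Fin (n + 2) → Set (Set ι)) (hU0 : ∀ ω, insert e ω ∈ U 0 ↔ ω ∈ U 0) (hU : ∀ j : Fin (n + 1), IsUpperSet (U j.succ))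

/-- The top coefficient `(−1)^n · [ Σ_i E'(1_{Piv_i} 1_{U_0}) ∏_{j≠i} E'(1_{Piv_j}) − E'(1_{U_0}) ∏_j E'(1_{Piv_j}) ]`, `Piv_j = Piv_e U_{j+1}`,
`E'` the `e`-free expectation (`= E_p` on `e`-free functions, `ex_eq_offEx`). [this work] -/
def topCoeff (p : ι → unitInterval) (e : ι) (U : Fin (n + 2) → Set (Set ι)) : ℝ :=
  (-1) ^ n * ((∑ i : Fin (n + 1), offEx p e (ind (pivSet e (U i.succ)) * ind (U 0)) *
      ∏ j ∈ univ.erase i, offEx p e (ind (pivSet e (U j.succ)))) -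
    offEx p e (ind (U 0)) * ∏ j : Fin (n + 1), offEx p e (ind (pivSet e (U j.succ))))

/-- The partially expanded family: slot `0 ↦ 1_{U_0}`; slot `j+1 ↦ x_e 1_{Piv_j}` or `1_{U_{j+1}^{e←0}}` (per `κ j`) for `j < r`, `1_{U_{j+1}}` for `j ≥ r`.
[this work] -/
def pfam (U : Fin (n + 2) → Set (Set ι)) (κ : Fin (n + 1) → Bool) (r : ℕ) : Fin (n + 2) → Set ι → ℝ :=
  Fin.cons (ind (U 0)) fun j => if (j : ℕ) < r then (if κ j then xInd e * ind (pivSet e (U j.succ)) else ind (secAt e false (U j.succ)))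
    else ind (U j.succ)

include hU in
omit [Fintype ι] in
/-- Resolving slot `r`: `pfam κ r` is `pfam (κ[r↦b]) (r+1)` with slot `r+1` replaced by `1_{U_{r+1}} = x_e 1_{Piv_r} + 1_{D_r}`. [this work] -/
theorem pfam_eq_update (κ : Fin (n + 1) → Bool) (r : Fin (n + 1)) (b : Bool) :
    pfam e U κ r = update (pfam e U (update κ r b) ((r : ℕ) + 1)) r.succ
      (xInd e * ind (pivSet e (U r.succ)) + ind (secAt e false (U r.succ))) := by
  funext j
  refine Fin.cases ?_ (fun j => ?_) j
  · rw [update_of_ne (Fin.succ_ne_zero r).symm]; rfl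
  · by_cases hj : j = r
    · subst hj
      rw [update_self]
      simp only [pfam, Fin.cons_succ, lt_self_iff_false, if_false]
      rw [ind_eq_secAt_add_xInd_mul e (hU j)]
      exact add_comm _ _
    · rw [update_of_ne (fun h => hj (Fin.succ_injective _ h))]
      simp only [pfam, Fin.cons_succ, update_of_ne hj]
      have : (j : ℕ) ≠ r := fun h => hj (Fin.ext h)
      by_cases h1 : (j : ℕ) < r
      · rw [if_pos h1, if_pos (show (j : ℕ) < (r : ℕ) + 1 by omega)]
      · rw [if_neg h1, if_neg (show ¬ ((j : ℕ) < (r : ℕ) + 1) by omega)]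

omit [Fintype ι] in
/-- The `x_e`-resolution of slot `r`. [this work] -/
theorem pfam_update_succ_true (κ : Fin (n + 1) → Bool) (r : Fin (n + 1)) (b : Bool) :
    update (pfam e U (update κ r b) ((r : ℕ) + 1)) r.succ (xInd e * ind (pivSet e (U r.succ))) = pfam e U (update κ r true) ((r : ℕ) + 1) := by
  funext j
  refine Fin.cases ?_ (fun j => ?_) j
  · rw [update_of_ne (Fin.succ_ne_zero r).symm]; rfl
  · by_cases hj : j = r
    · subst hj
      rw [update_self]
      simp [pfam]
    · rw [update_of_ne (fun h => hj (Fin.succ_injective _ h))]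
      simp only [pfam, Fin.cons_succ, update_of_ne hj]

omit [Fintype ι] in
/-- The `1_{D_r}`-resolution of slot `r`. [this work] -/
theorem pfam_update_succ_false (κ : Fin (n + 1) → Bool) (r : Fin (n + 1)) (b : Bool) :
    update (pfam e U (update κ r b) ((r : ℕ) + 1)) r.succ (ind (secAt e false (U r.succ))) = pfam e U (update κ r false) ((r : ℕ) + 1) := by
  funext j
  refine Fin.cases ?_ (fun j => ?_) j
  · rw [update_of_ne (Fin.succ_ne_zero r).symm]; rfl
  · by_cases hj : j = r
    · subst hj
      rw [update_self]
      simp [pfam]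
    · rw [update_of_ne (fun h => hj (Fin.succ_injective _ h))]
      simp only [pfam, Fin.cons_succ, update_of_ne hj]

omit [Fintype ι] in
/-- The fully resolved family is of `x_e`-form (head `e`-free). [this work] -/
theorem pfam_full_eq_xform (κ : Fin (n + 1) → Bool) :
    pfam e U κ (n + 1) = xform e (Fin.cons false κ)
      (Fin.cons (ind (U 0)) fun j => if κ j then ind (pivSet e (U j.succ)) else ind (secAt e false (U j.succ))) := by
  funext j
  refine Fin.cases ?_ (fun j => ?_) j
  · simp [pfam, xform]
  · simp only [pfam, xform, Fin.cons_succ, if_pos j.isLt]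
    by_cases h : κ j = true
    · rw [if_pos h, if_pos h, if_pos h]
    · rw [if_neg h, if_neg h, if_neg h]

include hU0 hU in
/-- **The expansion**: for every `r ≤ n + 1` and kinds `κ`, `s ↦ E_{n+2}(μ_{p[e↦s]}; pfam κ r)` is a polynomial of degree `≤ n + 1` whose
`s^{n+1}`-coefficient is `topCoeff` if all resolved slots carry `x_e` and `0` otherwise. [this work] -/
theorem exists_poly_pfam : ∀ (m : ℕ) (r : ℕ) (κ : Fin (n + 1) → Bool), r + m = n + 1 →
    ∃ Q : ℝ[X], Q.natDegree ≤ n + 1 ∧ (∀ s : unitInterval, sahiE (bernoulliWeight (update p e s)) (n + 2) (pfam e U κ r) = Q.eval (s : ℝ)) ∧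
      Q.coeff (n + 1) = if ∀ j : Fin (n + 1), (j : ℕ) < r → κ j = true then topCoeff p e U else 0
  | 0, r, κ, hr => by
    have hr' : r = n + 1 := by omega
    subst hr'
    set G : Fin (n + 2) → Set ι → ℝ :=
      Fin.cons (ind (U 0)) fun j => if κ j then ind (pivSet e (U j.succ)) else ind (secAt e false (U j.succ)) with hGdef
    have hG : ∀ j, Ignores e (G j) := fun j => by
      refine Fin.cases ?_ (fun j => ?_) j
      · exact ignores_ind_of_forall_iff hU0
      · simp only [hGdef, Fin.cons_succ]
        split_ifs
        · exact ignores_ind_pivSet e _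
        · exact ignores_ind_secAt e false _
    rw [pfam_full_eq_xform]
    by_cases hall : ∀ j : Fin (n + 1), (j : ℕ) < n + 1 → κ j = true
    · -- all resolved slots carry `x_e`: the head-free lemma gives the top coefficient
      have hκ : ∀ j, κ j = true := fun j => hall j j.isLt
      have hfam : xform e (Fin.cons false κ) G = Matrix.vecCons (ind (U 0)) (fun j => xInd e * ind (pivSet e (U j.succ))) := by
        funext j
        refine Fin.cases ?_ (fun j => ?_) j
        · simp [xform, hGdef]
        · simp only [xform, Fin.cons_succ, hκ j, if_true, hGdef, Matrix.cons_val_succ]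
      obtain ⟨Q, h1, h2, h3⟩ := exists_poly_head_free p e n (ignores_ind_of_forall_iff hU0) (fun j => ind (pivSet e (U j.succ)))
        fun j => ignores_ind_pivSet e _
      refine ⟨Q, h1, fun s => by rw [hfam, h2 s], ?_⟩
      rw [if_pos hall, h3, topCoeff]
    · -- some resolved slot is `1_{D_j}`: fewer than `n + 1` slots carry `x_e`
      obtain ⟨Q, h1, h2, -⟩ := exists_poly_xform p e (n + 2) (Fin.cons false κ) G hG
      have hlt : (univ.filter fun j => (Fin.cons false κ : Fin (n + 2) → Bool) j = true).card < n + 1 := by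
        push Not at hall
        obtain ⟨j0, -, hj0⟩ := hall
        rw [card_filter_succ]
        simp only [Fin.cons_zero, Bool.false_eq_true, if_false, zero_add, Fin.cons_succ]
        calc (univ.filter fun j => κ j = true).card ≤ (univ.erase j0).card :=
              card_le_card fun j hj => mem_erase.2 ⟨fun h => hj0 (h ▸ (mem_filter.1 hj).2), mem_univ _⟩
          _ = n := by rw [card_erase_of_mem (mem_univ _), card_univ, Fintype.card_fin]; rfl
          _ < n + 1 := by omega
      refine ⟨Q, h1.trans hlt.le, h2, ?_⟩
      rw [if_neg hall]
      exact coeff_eq_zero_of_natDegree_lt (h1.trans_lt hlt)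
  | m + 1, r, κ, hr => by
    have hrn : r < n + 1 := by omega
    set rr : Fin (n + 1) := ⟨r, hrn⟩ with hrr
    have hrr' : (rr : ℕ) = r := rfl
    obtain ⟨QX, hX1, hX2, hX3⟩ := exists_poly_pfam m (r + 1) (update κ rr true) (by omega)
    obtain ⟨QD, hD1, hD2, hD3⟩ := exists_poly_pfam m (r + 1) (update κ rr false) (by omega)
    refine ⟨QX + QD, (natDegree_add_le _ _).trans (max_le hX1 hD1), fun s => ?_, ?_⟩
    · have h := pfam_eq_update e U hU κ rr true
      rw [hrr'] at h
      rw [h, sahiE_update_add, pfam_update_succ_true e U κ rr true, pfam_update_succ_false e U κ rr true, hrr', hX2 s, hD2 s,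
        eval_add]
    · rw [coeff_add, hX3, hD3]
      have hD : ¬ ∀ j : Fin (n + 1), (j : ℕ) < r + 1 → update κ rr false j = true := fun h => by
        have := h rr (by rw [hrr']; omega)
        rw [update_self] at this
        exact Bool.false_ne_true this
      rw [if_neg hD, add_zero]
      by_cases hall : ∀ j : Fin (n + 1), (j : ℕ) < r → κ j = true
      · rw [if_pos hall, if_pos]
        intro j hj
        by_cases hjr : j = rr
        · subst hjr; rw [update_self]
        · rw [update_of_ne hjr]
          have : (j : ℕ) ≠ r := fun h => hjr (Fin.ext (by rw [hrr']; exact h))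
          exact hall j (by omega)
      · rw [if_neg hall, if_neg]
        intro h
        refine hall fun j hj => ?_
        have hjr : j ≠ rr := fun h' => by
          rw [h', hrr'] at hj
          exact lt_irrefl _ hj
        have := h j (by omega)
        rwa [update_of_ne hjr] at this

include hU0 hU in
/-- **THE LEADING COEFFICIENT (all orders).**  For `n + 2` events `U_0,…,U_{n+1}` with `U_0` `e`-free and `U_1,…,U_{n+1}` increasing,
`s ↦ E_{n+2}(μ_{p[e↦s]}; 1_{U_0},…,1_{U_{n+1}})` is a real polynomial of degree `≤ n + 1` with `s^{n+1}`-coefficient `topCoeff p e U`. [this work] -/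
theorem exists_poly_sahiE_update :
    ∃ Q : ℝ[X], Q.natDegree ≤ n + 1 ∧ (∀ s : unitInterval, sahiE (bernoulliWeight (update p e s)) (n + 2) (fun j => ind (U j)) = Q.eval (s : ℝ)) ∧
      Q.coeff (n + 1) = topCoeff p e U := by
  obtain ⟨Q, h1, h2, h3⟩ := exists_poly_pfam p e U hU0 hU (n + 1) 0 (fun _ => true) (by omega)
  have hfam : pfam e U (fun _ => true) 0 = fun j => ind (U j) := by
    funext j
    refine Fin.cases rfl (fun j => ?_) j
    simp [pfam]
  refine ⟨Q, h1, fun s => by rw [← hfam, h2 s], ?_⟩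
  rw [h3, if_pos fun j hj => absurd hj (Nat.not_lt_zero _)]

/-! ### The detector -/

/-- `n + 2` distinct interior parameter values `(m+1)/(n+3)`. [this work] -/
def gridPt (n : ℕ) (m : Fin (n + 2)) : unitInterval :=
  ⟨((m : ℕ) + 1 : ℝ) / (n + 3), by positivity, by
    rw [div_le_one (by positivity)]; have := m.isLt; exact_mod_cast (by omega : (m : ℕ) + 1 ≤ n + 3)⟩

/-- The grid points are interior. [this work] -/
theorem gridPt_mem_Ioo (n : ℕ) (m : Fin (n + 2)) : (gridPt n m : ℝ) ∈ Set.Ioo (0 : ℝ) 1 := by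
  refine ⟨by simp only [gridPt]; positivity, ?_⟩
  simp only [gridPt]
  rw [div_lt_one (by positivity)]
  have := m.isLt
  exact_mod_cast (by omega : (m : ℕ) + 1 < n + 3)

/-- The grid is injective. [this work] -/
theorem gridPt_injective (n : ℕ) : Function.Injective fun m : Fin (n + 2) => (gridPt n m : ℝ) := by
  intro a b h
  simp only [gridPt] at h
  have h' : ((a : ℕ) + 1 : ℝ) = (b : ℕ) + 1 := by
    have hne : ((n : ℝ) + 3) ≠ 0 := by positivity
    field_simp at h
    linarith
  exact Fin.ext (by exact_mod_cast (by linarith : ((a : ℕ) : ℝ) = (b : ℕ)))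

include hU0 hU in
/-- **THE `(k−1)`-SHARED-COORDINATE DETECTOR (all orders).**  If `topCoeff p e U ≠ 0` then `E_{n+2}(μ_{p[e↦s]}; 1_U) ≠ 0` for one of the `n + 2`
interior values `s = (m+1)/(n+3)`. [this work] -/
theorem exists_sahiE_update_ne_zero_of_topCoeff_ne_zero (hc : topCoeff p e U ≠ 0) :
    ∃ m : Fin (n + 2), sahiE (bernoulliWeight (update p e (gridPt n m))) (n + 2) (fun j => ind (U j)) ≠ 0 := by
  obtain ⟨Q, h1, h2, h3⟩ := exists_poly_sahiE_update p e U hU0 hU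
  by_contra hall
  push Not at hall
  have hQ : Q = 0 := eq_zero_of_natDegree_lt_card_of_eval_eq_zero Q (gridPt_injective n) (fun m => by rw [← h2]; exact hall m)
    (by rw [Fintype.card_fin]; omega)
  rw [hQ, coeff_zero] at h3
  exact hc h3.symm

include hU0 hU in
/-- The same with an explicitly interior parameter vector: if `p` is interior off `e` then `p[e ↦ (m+1)/(n+3)]` is interior. [this work] -/
theorem exists_interior_sahiE_ne_zero_of_topCoeff_ne_zero (hp : ∀ i, i ≠ e → (p i : ℝ) ∈ Set.Ioo (0 : ℝ) 1) (hc : topCoeff p e U ≠ 0) :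
    ∃ q : ι → unitInterval, (∀ i, (q i : ℝ) ∈ Set.Ioo (0 : ℝ) 1) ∧ sahiE (bernoulliWeight q) (n + 2) (fun j => ind (U j)) ≠ 0 := by
  obtain ⟨m, hm⟩ := exists_sahiE_update_ne_zero_of_topCoeff_ne_zero p e U hU0 hU hc
  refine ⟨update p e (gridPt n m), fun i => ?_, hm⟩
  by_cases hi : i = e
  · subst hi; rw [update_self]; exact gridPt_mem_Ioo n m
  · rw [update_of_ne hi]; exact hp i hi

end Events


/-! ### The apex criterion -/

section Apex

variable {n : ℕ} (U : Fin (n + 2) → Set (Set ι)) (hU0 : ∀ ω, insert e ω ∈ U 0 ↔ ω ∈ U 0) (hU : ∀ j : Fin (n + 1), IsUpperSet (U j.succ))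

/-- `E_p(1_A) ≥ μ_p(ω) > 0` for `ω ∈ A` and interior `p`. [folklore] -/
theorem ex_ind_pos_of_mem {p : ι → unitInterval} (hp : ∀ i, (p i : ℝ) ∈ Set.Ioo (0 : ℝ) 1) {A : Set (Set ι)} {ω : Set ι} (hω : ω ∈ A) :
    0 < ex (bernoulliWeight p) (ind A) := by
  rw [ex]
  calc (0 : ℝ) < bernoulliWeight p ω * ind A ω := by rw [ind_of_mem hω, mul_one]; exact bernoulliWeight_pos hp ω
    _ ≤ ∑ x, bernoulliWeight p x * ind A x :=
      single_le_sum (f := fun x => bernoulliWeight p x * ind A x)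
        (fun x _ => mul_nonneg ((isFKGMeasure_bernoulliWeight p).nonneg x) (ind_nonneg _ _)) (mem_univ ω)

include hU0 hU in
/-- **THE APEX CRITERION (all orders).**  Let `U_0,…,U_{n+1}` be increasing events with `U_0` `e`-free, `e` pivotal for each of `U_1,…,U_{n+1}`, and
`e` an APEX of `U_1` (every configuration of `U_1` contains `e`, i.e. `U_1^{e←0} = ∅`).  If `U_1^{e←1}` and `U_0` are strictly positively correlated under
the interior product measure `μ_p` (`E(1_{U_1^{e←1}} 1_{U_0}) ≠ E(1_{U_1^{e←1}})E(1_{U_0})`; by strict Harris: they share an essential coordinate), then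
`E_{n+2}(μ_q; 1_U) ≠ 0` for some interior `q` (`= p` off `e`): the leading coefficient is `≥ Cov(U_1^{e←1},U_0)·∏_{j≥2} μ_p(Piv_e U_j) > 0`. [this work] -/
theorem exists_interior_sahiE_ne_zero_of_apex (hp : ∀ i, (p i : ℝ) ∈ Set.Ioo (0 : ℝ) 1) (hU0up : IsUpperSet (U 0))
    (hpiv : ∀ j : Fin (n + 1), ∃ ω, e ∉ ω ∧ ω ∉ U j.succ ∧ insert e ω ∈ U j.succ)
    (hapex : ∀ ω, ω \ {e} ∉ U 1)
    (hcov : ex (bernoulliWeight p) (ind (secAt e true (U 1)) * ind (U 0)) ≠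
      ex (bernoulliWeight p) (ind (secAt e true (U 1))) * ex (bernoulliWeight p) (ind (U 0))) :
    ∃ q : ι → unitInterval, (∀ i, (q i : ℝ) ∈ Set.Ioo (0 : ℝ) 1) ∧ sahiE (bernoulliWeight q) (n + 2) (fun j => ind (U j)) ≠ 0 := by
  refine exists_interior_sahiE_ne_zero_of_topCoeff_ne_zero p e U hU0 hU (fun i _ => hp i) ?_
  -- abbreviations: `c j = μ(Piv_j) > 0`, `a j = μ(Piv_j ∩ U_0) ≥ 0`, `u = μ(U_0)`
  set c : Fin (n + 1) → ℝ := fun j => offEx p e (ind (pivSet e (U j.succ))) with hc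
  set a : Fin (n + 1) → ℝ := fun j => offEx p e (ind (pivSet e (U j.succ)) * ind (U 0)) with ha
  set u : ℝ := offEx p e (ind (U 0)) with hu
  have hig0 : Ignores e (ind (U 0)) := ignores_ind_of_forall_iff hU0
  have hc_eq : ∀ j, c j = ex (bernoulliWeight p) (ind (pivSet e (U j.succ))) := fun j => (ex_eq_offEx p e (ignores_ind_pivSet e _)).symm
  have ha_eq : ∀ j, a j = ex (bernoulliWeight p) (ind (pivSet e (U j.succ)) * ind (U 0)) :=
    fun j => (ex_eq_offEx p e ((ignores_ind_pivSet e _).mul hig0)).symm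
  have hu_eq : u = ex (bernoulliWeight p) (ind (U 0)) := (ex_eq_offEx p e hig0).symm
  have hc_pos : ∀ j, 0 < c j := fun j => by
    obtain ⟨ω, hωe, hω0, hω1⟩ := hpiv j
    rw [hc_eq]
    refine ex_ind_pos_of_mem hp (ω := ω) ((Set.mem_sdiff _).2 ⟨mem_secAt.2 (by simpa [forceAt] using hω1), fun h => hω0 ?_⟩)
    have := mem_secAt.1 h
    simpa [forceAt, Set.sdiff_singleton_eq_self hωe] using this
  have ha_nn : ∀ j, 0 ≤ a j := fun j => by
    rw [ha_eq]
    exact ex_nonneg (isFKGMeasure_bernoulliWeight p).nonneg fun ω => mul_nonneg (ind_nonneg _ _) (ind_nonneg _ _)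
  -- the apex slot: `Piv_0 = U_1^{e←1}`
  have hpiv0 : pivSet e (U 1) = secAt e true (U 1) := by
    ext ω
    rw [pivSet, Set.mem_sdiff]
    exact ⟨fun h => h.1, fun h => ⟨h, fun h' => hapex ω (mem_secAt.1 h')⟩⟩
  have h1 : (1 : Fin (n + 2)) = (0 : Fin (n + 1)).succ := rfl
  have hcov' : u * c 0 < a 0 := by
    rw [hu_eq, hc_eq, ha_eq, ← h1, hpiv0]
    refine lt_of_le_of_ne ?_ (fun h => hcov ?_)
    · rw [mul_comm]
      exact ex_mul_ex_le_ex_mul p (monotone_ind_of_isUpperSet (isUpperSet_secAt e true (hU 0))) (monotone_ind_of_isUpperSet hU0up)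
    · rw [← h, mul_comm]
  -- regroup the bracket around the apex slot
  have hbr : (∑ i : Fin (n + 1), a i * ∏ j ∈ univ.erase i, c j) - u * ∏ j, c j =
      (a 0 - u * c 0) * (∏ j ∈ univ.erase 0, c j) + ∑ i : Fin n, a i.succ * ∏ j ∈ univ.erase i.succ, c j := by
    rw [Fin.sum_univ_succ, ← mul_prod_erase univ c (mem_univ 0)]
    ring
  have hpos : 0 < (∑ i : Fin (n + 1), a i * ∏ j ∈ univ.erase i, c j) - u * ∏ j, c j := by
    rw [hbr]
    refine add_pos_of_pos_of_nonneg (mul_pos (sub_pos.2 hcov') (prod_pos fun j _ => hc_pos j)) ?_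
    exact sum_nonneg fun i _ => mul_nonneg (ha_nn _) (prod_nonneg fun j _ => (hc_pos j).le)
  rw [topCoeff]
  exact mul_ne_zero (pow_ne_zero _ (by norm_num)) hpos.ne'

end Apex

end SharedCoordinate

end Summit.CriticalPhenomena.PercolationContinuityZ3.Theorems
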